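import Summits.ValiantsHypothesis.ValiantsHypothesis.Theorems.LiftNullstellensatzLiftWidthPerFourRungOneKoszul
import Mathlib.LinearAlgebra.Matrix.Rank

/-!
# Route LiftNullstellensatz — `LiftWidthPerFour` (stmt-ValiantsHypothesis-5922), CASE A rung 1:
the core contradiction (no width-`5` linear factorization of `G|_{y₀ = z₀ = 0}`)

Normalised indices (middle rows `1, 2`, killed column `0`, live columns `1, 2, 3`;
`q' = (p23, p13, p12)`, `p_bd = y_b z_d + y_d z_b`).  Restricting a hypothetical width-`5` middle
layer of a `(4,5,4)`-ABP for `per_4` to `{y₀ = z₀ = 0}` produces (`CASEA-RUNG1-p2.md` §2)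
`Ā ∈ R₁^{3×5}`, `C̄ ∈ R₁^{5×3}`, `a, c ∈ R⁵` with `Ā C̄ = 0`, `Ā c = q'`, `aᵀ C̄ = q'ᵀ`.
This file shows that no such data exist (`false_of_G1_blocks`):

* `eq_zero_of_perm_mul_eq_perm_mul` — `p_bd f = p_kd g` with linear `f, g` forces `f = g = 0`;
* `false_of_minor2_eq_zero` — if all `2 × 2` minors of `Ā` vanish then `Ā = 0`, contradicting
  `Ā c = q' ≠ 0` (rank `≤ 1` step);
* `minor2_eq_zero_of_minor3_eq_zero` — if all `3 × 3` minors of `Ā` vanish then all `2 × 2`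
  minors vanish (rank-`2` step: the cross product of two columns is orthogonal to `q'`, hence zero
  by `minors_eq_zero_of_cross_dot_eq_zero`);
* `minor3_eq_zero_of_mul_eq_zero` — Sylvester: `Ā C̄ = 0` and a nonzero `3 × 3` minor of `Ā`
  force all `3 × 3` minors of `C̄` to vanish (ranks over the fraction field);
* `false_of_G1_blocks` — assembly (the transposed data `(C̄ᵀ, Āᵀ, c, a)` satisfy the same
  hypotheses).

No new definitions.  VP ≠ VNP is not moved by this item.
-/

noncomputable section

open MvPolynomial

namespace Summit.ValiantsHypothesis.LiftNullstellensatz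

variable {K : Type*} [Field K]

/-- `p_bd · f = p_kd · g` with linear forms `f, g` (distinct `k, b, d`) forces `f = 0` and `g = 0`:
kill column `k` (resp. `b`) to see `f ∈ span(y_k, z_k)`, `g ∈ span(y_b, z_b)`, then evaluate at
three `0/1` points. [folklore] -/
theorem eq_zero_of_perm_mul_eq_perm_mul {k b d : Fin 4} (hkb : k ≠ b) (hkd : k ≠ d) (hbd : b ≠ d)
    (f g : MvPolynomial (Fin 4 × Fin 4) K) (hf : f.IsHomogeneous 1) (hg : g.IsHomogeneous 1)
    (h : (X (1, b) * X (2, d) + X (1, d) * X (2, b)) * f =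
      (X (1, k) * X (2, d) + X (1, d) * X (2, k)) * g) :
    f = 0 ∧ g = 0 := by
  classical
  -- f ∈ span(y_k, z_k)
  obtain ⟨a₁, a₂, hf'⟩ : ∃ a₁ a₂ : K, f = C a₁ * X (1, k) + C a₂ * X (2, k) := by
    refine exists_pair_of_kill_eq_zero (by simp) hf
      (aeval_eq_zero_of_syzygy (k := k) hbd _ ?_ ?_ ?_ ?_ ?_ ?_ f (-g) 0 ?_) <;>
      try simp [hkb.symm, hkd.symm]
    linear_combination h
  -- g ∈ span(y_b, z_b)
  obtain ⟨b₁, b₂, hg'⟩ : ∃ b₁ b₂ : K, g = C b₁ * X (1, b) + C b₂ * X (2, b) := by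
    refine exists_pair_of_kill_eq_zero (by simp) hg
      (aeval_eq_zero_of_syzygy (k := b) (b := k) (d := d) hkd _ ?_ ?_ ?_ ?_ ?_ ?_ g (-f) 0 ?_) <;>
      try simp [hkb, hbd.symm]
    linear_combination -h
  rw [hf', hg'] at h
  have ev : ∀ S : Finset (Fin 4 × Fin 4), eval (fun w => if w ∈ S then (1 : K) else 0)
      ((X (1, b) * X (2, d) + X (1, d) * X (2, b)) * (C a₁ * X (1, k) + C a₂ * X (2, k))) =
      eval (fun w => if w ∈ S then (1 : K) else 0)
      ((X (1, k) * X (2, d) + X (1, d) * X (2, k)) * (C b₁ * X (1, b) + C b₂ * X (2, b))) := by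
    intro S; rw [h]
  have q1 := ev {(1, k), (1, d), (2, b)}
  have q2 := ev {(2, k), (1, b), (2, d)}
  simp only [map_add, map_mul, eval_X, eval_C, Finset.mem_insert, Finset.mem_singleton,
    Prod.mk.injEq, Fin.reduceEq, hkb, hkd, hbd, hkb.symm, hkd.symm, hbd.symm, and_true, and_false,
    or_false, or_true, if_true, if_false, mul_one, mul_zero, zero_mul, add_zero, zero_add] at q1 q2
  have ha₁ : a₁ = 0 := by simpa using q1
  have ha₂ : a₂ = 0 := by simpa using q2
  have hf0 : f = 0 := by rw [hf', ha₁, ha₂, map_zero, zero_mul, zero_mul, add_zero]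
  refine ⟨hf0, ?_⟩
  have hg0 : (X (1, k) * X (2, d) + X (1, d) * X (2, k)) * g = 0 := by
    rw [hg']
    rw [ha₁, ha₂, map_zero] at h
    linear_combination -h
  exact (mul_eq_zero.1 hg0).resolve_left (perm22_ne_zero k d hkd)

/-- Rank `≤ 1` is impossible: if `Ā c = q'` (linear `Ā`) and all `2 × 2` minors of `Ā` vanish,
contradiction (every column of `Ā` is then parallel to `q'`, hence zero by
`eq_zero_of_perm_mul_eq_perm_mul`, so `q' = Ā c = 0`). [folklore] -/
theorem false_of_minor2_eq_zero (A : Fin 3 → Fin 5 → MvPolynomial (Fin 4 × Fin 4) K)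
    (hA : ∀ i s, (A i s).IsHomogeneous 1) (c : Fin 5 → MvPolynomial (Fin 4 × Fin 4) K)
    (hq0 : ∑ s, A 0 s * c s = X (1, 2) * X (2, 3) + X (1, 3) * X (2, 2))
    (hq1 : ∑ s, A 1 s * c s = X (1, 1) * X (2, 3) + X (1, 3) * X (2, 1))
    (hq2 : ∑ s, A 2 s * c s = X (1, 1) * X (2, 2) + X (1, 2) * X (2, 1))
    (hmin : ∀ s t, A 0 s * A 1 t - A 1 s * A 0 t = 0 ∧ A 0 s * A 2 t - A 2 s * A 0 t = 0) :
    False := by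
  have hcol : ∀ s, A 0 s = 0 ∧ A 1 s = 0 ∧ A 2 s = 0 := by
    intro s
    simp only [Fin.sum_univ_five] at hq0 hq1 hq2
    -- p23 · A 1 s = p13 · A 0 s and p23 · A 2 s = p12 · A 0 s
    have e01 : (X (1, 2) * X (2, 3) + X (1, 3) * X (2, 2)) * A 1 s =
        (X (1, 1) * X (2, 3) + X (1, 3) * X (2, 1)) * A 0 s := by
      linear_combination (-1 : MvPolynomial (Fin 4 × Fin 4) K) * A 1 s * hq0 + A 0 s * hq1 -
        c 0 * (hmin s 0).1 - c 1 * (hmin s 1).1 - c 2 * (hmin s 2).1 - c 3 * (hmin s 3).1 -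
        c 4 * (hmin s 4).1
    have e02 : (X (1, 3) * X (2, 2) + X (1, 2) * X (2, 3)) * A 2 s =
        (X (1, 1) * X (2, 2) + X (1, 2) * X (2, 1)) * A 0 s := by
      linear_combination (-1 : MvPolynomial (Fin 4 × Fin 4) K) * A 2 s * hq0 + A 0 s * hq2 -
        c 0 * (hmin s 0).2 - c 1 * (hmin s 1).2 - c 2 * (hmin s 2).2 - c 3 * (hmin s 3).2 -
        c 4 * (hmin s 4).2
    obtain ⟨h1, h0⟩ := eq_zero_of_perm_mul_eq_perm_mul (k := 1) (b := 2) (d := 3) (by decide)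
      (by decide) (by decide) _ _ (hA 1 s) (hA 0 s) e01
    obtain ⟨h2', -⟩ := eq_zero_of_perm_mul_eq_perm_mul (k := 1) (b := 3) (d := 2) (by decide)
      (by decide) (by decide) _ _ (hA 2 s) (hA 0 s) e02
    exact ⟨h0, h1, h2'⟩
  have : (X (1, 2) * X (2, 3) + X (1, 3) * X (2, 2) : MvPolynomial (Fin 4 × Fin 4) K) = 0 := by
    rw [← hq0]
    exact Finset.sum_eq_zero fun s _ => by rw [(hcol s).1, zero_mul]
  exact perm22_ne_zero 2 3 (by decide) this

/-- Rank `2` is impossible: if `Ā c = q'` (linear `Ā`) and all `3 × 3` minors of `Ā` vanish, then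
all `2 × 2` minors of `Ā` vanish.  (For two columns `ℓ, m`: `q' · (ℓ × m) = Σ_t c_t det[ℓ, m, Ā_t] = 0`,
so `ℓ × m = 0` by `minors_eq_zero_of_cross_dot_eq_zero`.) [folklore] -/
theorem minor2_eq_zero_of_minor3_eq_zero (h2 : (2 : K) ≠ 0)
    (A : Fin 3 → Fin 5 → MvPolynomial (Fin 4 × Fin 4) K)
    (hA : ∀ i s, (A i s).IsHomogeneous 1) (c : Fin 5 → MvPolynomial (Fin 4 × Fin 4) K)
    (hq0 : ∑ s, A 0 s * c s = X (1, 2) * X (2, 3) + X (1, 3) * X (2, 2))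
    (hq1 : ∑ s, A 1 s * c s = X (1, 1) * X (2, 3) + X (1, 3) * X (2, 1))
    (hq2 : ∑ s, A 2 s * c s = X (1, 1) * X (2, 2) + X (1, 2) * X (2, 1))
    (h3 : ∀ t s s', A 0 t * (A 1 s * A 2 s' - A 2 s * A 1 s') +
      A 1 t * (A 2 s * A 0 s' - A 0 s * A 2 s') + A 2 t * (A 0 s * A 1 s' - A 1 s * A 0 s') = 0) :
    ∀ s s', A 1 s * A 2 s' - A 2 s * A 1 s' = 0 ∧ A 2 s * A 0 s' - A 0 s * A 2 s' = 0 ∧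
      A 0 s * A 1 s' - A 1 s * A 0 s' = 0 := by
  intro s s'
  simp only [Fin.sum_univ_five] at hq0 hq1 hq2
  refine minors_eq_zero_of_cross_dot_eq_zero h2 (A 0 s) (A 1 s) (A 2 s) (A 0 s') (A 1 s') (A 2 s')
    (hA 0 s) (hA 1 s) (hA 2 s) (hA 0 s') (hA 1 s') (hA 2 s') ?_
  rw [← hq0, ← hq1, ← hq2]
  linear_combination c 0 * h3 0 s s' + c 1 * h3 1 s s' + c 2 * h3 2 s s' + c 3 * h3 3 s s' +
    c 4 * h3 4 s s'

/-- From `Ā c = q'` with all `3 × 3` minors of `Ā` vanishing: contradiction (rank `≤ 2` is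
impossible). [folklore] -/
theorem false_of_minor3_eq_zero (h2 : (2 : K) ≠ 0)
    (A : Fin 3 → Fin 5 → MvPolynomial (Fin 4 × Fin 4) K)
    (hA : ∀ i s, (A i s).IsHomogeneous 1) (c : Fin 5 → MvPolynomial (Fin 4 × Fin 4) K)
    (hq0 : ∑ s, A 0 s * c s = X (1, 2) * X (2, 3) + X (1, 3) * X (2, 2))
    (hq1 : ∑ s, A 1 s * c s = X (1, 1) * X (2, 3) + X (1, 3) * X (2, 1))
    (hq2 : ∑ s, A 2 s * c s = X (1, 1) * X (2, 2) + X (1, 2) * X (2, 1))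
    (h3 : ∀ t s s', A 0 t * (A 1 s * A 2 s' - A 2 s * A 1 s') +
      A 1 t * (A 2 s * A 0 s' - A 0 s * A 2 s') + A 2 t * (A 0 s * A 1 s' - A 1 s * A 0 s') = 0) :
    False := by
  have hm := minor2_eq_zero_of_minor3_eq_zero h2 A hA c hq0 hq1 hq2 h3
  refine false_of_minor2_eq_zero A hA c hq0 hq1 hq2 fun s t => ⟨?_, ?_⟩
  · linear_combination (hm s t).2.2
  · linear_combination (-1 : MvPolynomial (Fin 4 × Fin 4) K) * (hm s t).2.1

/-- **Sylvester step** (any integral domain): if `A B = 0` for `A : 3 × 5`, `B : 5 × 3` and some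
`3 × 3` minor of `A` is nonzero, then every `3 × 3` minor of `B` vanishes (over the fraction field,
`rank A = 3`, so `rank B ≤ 5 - 3 = 2`). [folklore] -/
theorem minor3_eq_zero_of_mul_eq_zero {R : Type*} [CommRing R] [IsDomain R]
    (A : Matrix (Fin 3) (Fin 5) R) (B : Matrix (Fin 5) (Fin 3) R) (hAB : A * B = 0)
    (f : Fin 3 → Fin 5) (hf : (A.submatrix id f).det ≠ 0) (g : Fin 3 → Fin 5) :
    (B.submatrix g id).det = 0 := by
  classical
  let F := FractionRing R
  let φ : R →+* F := algebraMap R F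
  have hφ : Function.Injective φ := IsFractionRing.injective R F
  set A' : Matrix (Fin 3) (Fin 5) F := A.map φ with hA'
  set B' : Matrix (Fin 5) (Fin 3) F := B.map φ with hB'
  have hAB' : A' * B' = 0 := by
    rw [hA', hB', ← Matrix.map_mul, hAB]; exact Matrix.map_zero _ (map_zero φ)
  -- rank A' = 3
  have hrA : A'.rank = 3 := by
    apply le_antisymm
    · simpa using A'.rank_le_card_height
    · have hdet : (A'.submatrix id f).det ≠ 0 := by
        have : A'.submatrix id f = φ.mapMatrix (A.submatrix id f) := rfl
        rw [this, ← RingHom.map_det]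
        exact fun h0 => hf (hφ (by rw [h0, map_zero]))
      have hu : IsUnit (A'.submatrix id f) :=
        (Matrix.isUnit_iff_isUnit_det _).2 (isUnit_iff_ne_zero.2 hdet)
      have h1 := Matrix.rank_of_isUnit _ hu
      have h2 := A'.rank_submatrix_le id f
      rw [h1, Fintype.card_fin] at h2
      exact h2
  -- range B' ≤ ker A'
  have hle : LinearMap.range B'.mulVecLin ≤ LinearMap.ker A'.mulVecLin := by
    rintro _ ⟨v, rfl⟩
    rw [LinearMap.mem_ker, Matrix.mulVecLin_apply, Matrix.mulVecLin_apply, Matrix.mulVec_mulVec,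
      hAB', Matrix.zero_mulVec]
  have hker : Module.finrank F (LinearMap.ker A'.mulVecLin) = 2 := by
    have := LinearMap.finrank_range_add_finrank_ker A'.mulVecLin
    rw [Module.finrank_fin_fun] at this
    change A'.rank + _ = 5 at this
    omega
  have hrB : B'.rank ≤ 2 := (Submodule.finrank_mono hle).trans hker.le
  -- so the 3×3 minor of B' on rows g vanishes
  by_contra hg
  have hdet : (B'.submatrix g id).det ≠ 0 := by
    have : B'.submatrix g id = φ.mapMatrix (B.submatrix g id) := rfl
    rw [this, ← RingHom.map_det]
    exact fun h0 => hg (hφ (by rw [h0, map_zero]))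
  have hu : IsUnit (B'.submatrix g id) :=
    (Matrix.isUnit_iff_isUnit_det _).2 (isUnit_iff_ne_zero.2 hdet)
  have h1 := Matrix.rank_of_isUnit _ hu
  have h2 := B'.rank_submatrix_le g id
  rw [h1, Fintype.card_fin] at h2
  omega

/-- Expansion of a `3 × 3` minor of a `3 × 5` array along its first column. [folklore] -/
theorem det_submatrix_three (A : Matrix (Fin 3) (Fin 5) (MvPolynomial (Fin 4 × Fin 4) K))
    (t s s' : Fin 5) :
    (A.submatrix id ![t, s, s']).det = A 0 t * (A 1 s * A 2 s' - A 2 s * A 1 s') +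
      A 1 t * (A 2 s * A 0 s' - A 0 s * A 2 s') + A 2 t * (A 0 s * A 1 s' - A 1 s * A 0 s') := by
  rw [Matrix.det_fin_three]
  simp only [Matrix.submatrix_apply, id_eq, Matrix.cons_val_zero, Matrix.cons_val_one,
    Matrix.cons_val]
  ring

/-- **Core of rung 1.**  There are no `Ā ∈ R₁^{3×5}`, `C̄ ∈ R₁^{5×3}`, `a, c ∈ R⁵`
(`R = K[x]`, `2 ≠ 0`) with `Ā C̄ = 0`, `Ā c = q'` and `aᵀ C̄ = q'ᵀ`, where
`q' = (p23, p13, p12)`: by `false_of_minor3_eq_zero` some `3 × 3` minor of `Ā` and (transposing)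
of `C̄` is nonzero, contradicting the Sylvester step. [folklore] -/
theorem false_of_G1_blocks (h2 : (2 : K) ≠ 0)
    (Ā : Matrix (Fin 3) (Fin 5) (MvPolynomial (Fin 4 × Fin 4) K))
    (Cb : Matrix (Fin 5) (Fin 3) (MvPolynomial (Fin 4 × Fin 4) K))
    (a c : Fin 5 → MvPolynomial (Fin 4 × Fin 4) K)
    (hĀ : ∀ i s, (Ā i s).IsHomogeneous 1) (hCb : ∀ s i, (Cb s i).IsHomogeneous 1)
    (h0 : Ā * Cb = 0)
    (hc : Ā.mulVec c = ![X (1, 2) * X (2, 3) + X (1, 3) * X (2, 2),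
      X (1, 1) * X (2, 3) + X (1, 3) * X (2, 1), X (1, 1) * X (2, 2) + X (1, 2) * X (2, 1)])
    (ha : Matrix.vecMul a Cb = ![X (1, 2) * X (2, 3) + X (1, 3) * X (2, 2),
      X (1, 1) * X (2, 3) + X (1, 3) * X (2, 1), X (1, 1) * X (2, 2) + X (1, 2) * X (2, 1)]) :
    False := by
  classical
  -- the entries of `Ā c = q'` and `aᵀ C̄ = q'ᵀ`
  have hc0 := congr_fun hc 0
  have hc1 := congr_fun hc 1
  have hc2 := congr_fun hc 2
  have ha0 := congr_fun ha 0
  have ha1 := congr_fun ha 1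
  have ha2 := congr_fun ha 2
  simp only [Matrix.mulVec, dotProduct, Matrix.vecMul, Matrix.cons_val_zero, Matrix.cons_val_one,
    Matrix.cons_val] at hc0 hc1 hc2 ha0 ha1 ha2
  -- some 3×3 minor of Ā is nonzero
  by_cases H : ∀ t s s', Ā 0 t * (Ā 1 s * Ā 2 s' - Ā 2 s * Ā 1 s') +
      Ā 1 t * (Ā 2 s * Ā 0 s' - Ā 0 s * Ā 2 s') + Ā 2 t * (Ā 0 s * Ā 1 s' - Ā 1 s * Ā 0 s') = 0
  · exact false_of_minor3_eq_zero h2 (fun i s => Ā i s) hĀ c hc0 hc1 hc2 H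
  push Not at H
  obtain ⟨t, s, s', hne⟩ := H
  rw [← det_submatrix_three] at hne
  -- hence all 3×3 minors of C̄ vanish; apply the rank-≤2 contradiction to C̄ᵀ
  refine false_of_minor3_eq_zero h2 (fun i s => Cb s i) (fun i s => hCb s i) a
    (by simpa [mul_comm] using ha0) (by simpa [mul_comm] using ha1) (by simpa [mul_comm] using ha2) ?_
  intro t' u u'
  have := minor3_eq_zero_of_mul_eq_zero Ā Cb h0 ![t, s, s'] hne ![t', u, u']
  rw [Matrix.det_fin_three] at this
  simp only [Matrix.submatrix_apply, id_eq, Matrix.cons_val_zero, Matrix.cons_val_one,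
    Matrix.cons_val] at this
  linear_combination this

end Summit.ValiantsHypothesis.LiftNullstellensatz

end
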